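import Literature.Topology.FourManifolds.FramedLinkTraceEuler
import HarnessLib

/-!
# Euler characteristics of the pieces of a 4-dimensional 2-handle attachment, with coefficients

Topic `Literature/Topology/FourManifolds`.  First of two files proving
`χ(B ∪ k two-handles; M) = χ(B; M) + k · rank M` for Kosinski's simultaneous attachment of
`2`-handles to an arbitrary Hausdorff `4`-manifold `B` (`HandleAttachingMap.IsMultiAttachment`,
`HandleAttachingMaps.lean`; Gompf–Stipsicz, *4-Manifolds and Kirby Calculus* (1999), §4.2 p. 111:
`χ = Σ (-1)ᵏ #(k-handles)`), continued in `MultiAttachmentEuler.lean`.  This file holds the two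
inputs that the tree's treatment of the case `B = D⁴` (`FramedLinkTraceEuler.lean`, coefficients
`ℤ`) does not provide:

* `finRelHomology_left_of_interior_cover`, `finRelHomology_left_of_isOpen_union`,
  `finRelHomology_left_of_isOpen_union_of_relEuler_eq` — **Mayer–Vietoris read backwards**
  (Hatcher 2002, §2.2 pp. 149–150): the homology of a piece `A` of an open cover `A ∪ T` is
  finitely generated and bounded together with that of `A ∪ T` and `A ∩ T` (`Hₙ(A)` is a direct
  summand of the middle term of the exact segment `Hₙ(A ∩ T) → Hₙ(A) ⊕ Hₙ(T) → Hₙ(A ∪ T)`, over a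
  Noetherian ring), and `χ(A) = χ(A ∪ T)` as soon as `χ(T) = χ(A ∩ T)` — used to pass from `B`
  to the base piece `B ∖ ⋃ᵢ h̄ᵢ(S)` of the attachment;
* `finRelHomology_of_homeomorph_sphere_one`, `…_handleTube₄`, `…_handleTube₄_lamSq_ne_one`,
  `…_beltPiece₄_lamSq_ne_zero`, `…_beltPiece₄` — **the models with coefficients in a finitely
  generated module `M`, for spaces in an arbitrary universe `u`** (rank–nullity being assumed
  only in universe `max u v`, as in `…SingularHomology.MayerVietorisEuler`): the circle
  (`χ = 0`, from the pair `(D², ∂D²)` lifted to universe `u`), Kosinski's tube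
  `T = {x ∈ D⁴ | x_λ ≠ 0}` and the punctured tube `T ∖ S` (both deformation retract onto a
  parallel circle, `TwoHandleTubeDeformationFour.lean`; `χ = 0`), its copy
  `{x ∈ D⁴ ∖ S | x_λ ≠ 0}` in the handle piece (`χ = 0`), and the contractible handle piece
  `D⁴ ∖ S` (`χ = rank M`).

Everything is proved; there are no definitions and no named facts.

## References

* R. E. Gompf, A. I. Stipsicz, *4-Manifolds and Kirby Calculus*, GSM 20 (1999), §4.2 p. 111.
  [GompfStipsiczGSM1999]
* A. A. Kosinski, *Differential Manifolds* (1993), VI §6. [Kosinski1993]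
* A. Hatcher, *Algebraic Topology* (2002), §2.2 pp. 149–150 (Mayer–Vietoris), Thm. 2.44,
  Example 2.17, Cor. 2.11, Prop. 2.7. [HatcherAT2002]
-/

open scoped Manifold ContDiff Topology
open Set Function Metric Topology CategoryTheory Limits

noncomputable section

namespace Literature.Topology.FourManifolds

open Literature.AlgebraicTopology.SingularHomology Literature.AlgebraicTopology.Homotopy

universe u v

/-! ### §1 Mayer–Vietoris read backwards: the homology of a piece from the union -/

section ReverseMV

variable (R : Type v) [CommRing R] [IsNoetherianRing R] (M : Type v) [AddCommGroup M] [Module R M]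
  {X : Type u} [TopologicalSpace X]

/-- **Mayer–Vietoris read backwards.**  If `interior U ∪ interior V = X` and the homology
(coefficients `M`) of `X` and of `U ∩ V` is finitely generated and vanishes from degree `N` on,
then so is the homology of `U`: in the exact segment `Hₙ(U ∩ V) → Hₙ(U) ⊕ Hₙ(V) → Hₙ(X)` the
middle term is finitely generated (Noetherian ring), resp. zero, with the outer two, and `Hₙ(U)`
is a direct summand of it (Hatcher 2002, §2.2 pp. 149–150).
[cite: HatcherAT2002, §2.2 pp. 149–150] -/
theorem finRelHomology_left_of_interior_cover {U V : Set X}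
    (hcov : interior U ∪ interior V = univ) {N : ℕ} (hX : FinRelHomology R M X ∅ N)
    (hUV : FinRelHomology R M (↥(U ∩ V)) ∅ N) : FinRelHomology R M (↥U) ∅ N := by
  have hex : ∀ k, (ShortComplex.mk _ _ (mayerVietoris.φ_comp_ψ R M U V k)).Exact :=
    fun k => mayerVietoris.exact₁_holds R M U V hcov k
  refine FinRelHomology.empty_of_absolute (fun k => ?_) fun k hk => ?_
  · haveI := hUV.finite_singularHomology k
    haveI := hX.finite_singularHomology k
    haveI : Module.Finite R ↑(singularHomology R M (↥U) k ⊞ singularHomology R M (↥V) k) :=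
      (hex k).moduleCat_finite_X₂
    exact Module.Finite.of_surjective
      (biprod.fst : singularHomology R M (↥U) k ⊞ singularHomology R M (↥V) k ⟶ _).hom
      ((ModuleCat.epi_iff_surjective _).1 inferInstance)
  · exact IsZero.of_mono
      (biprod.inl : singularHomology R M (↥U) k ⟶
        singularHomology R M (↥U) k ⊞ singularHomology R M (↥V) k)
      ((hex k).isZero_of_both_isZero (hUV.isZero_singularHomology k hk)
        (hX.isZero_singularHomology k hk))

/-- **Mayer–Vietoris read backwards, for two open subsets**: for open `A, B ⊆ X`, if the
homology of `A ∪ B` and of `A ∩ B` is finitely generated and vanishes from degree `N` on, then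
so is the homology of `A`. [cite: HatcherAT2002, §2.2 pp. 149–150] -/
theorem finRelHomology_left_of_isOpen_union {A B : Set X} (hA : IsOpen A) (hB : IsOpen B)
    {N : ℕ} (hU : FinRelHomology R M (↥(A ∪ B)) ∅ N)
    (hAB : FinRelHomology R M (↥(A ∩ B)) ∅ N) : FinRelHomology R M (↥A) ∅ N := by
  have hcov := SphereComplement.interior_union_interior_eq_univ hA hB
  let eA : ↥(Subtype.val ⁻¹' A : Set ↥(A ∪ B)) ≃ₜ ↥A :=
    SphereComplement.preimageValHomeomorphOfSubset subset_union_left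
  let eAB : ↥((Subtype.val ⁻¹' A : Set ↥(A ∪ B)) ∩ Subtype.val ⁻¹' B) ≃ₜ ↥(A ∩ B) :=
    SphereComplement.preimageValHomeomorphOfSubset (inter_subset_left.trans subset_union_left)
  have hUV : FinRelHomology R M
      ↥((Subtype.val ⁻¹' A : Set ↥(A ∪ B)) ∩ Subtype.val ⁻¹' B) ∅ N :=
    hAB.of_homeomorph eAB.symm (mapsTo_empty _ _) (mapsTo_empty _ _)
  exact (finRelHomology_left_of_interior_cover R M hcov hU hUV).of_homeomorph eA
    (mapsTo_empty _ _) (mapsTo_empty _ _)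

variable [HasRankNullity.{max u v} R]

/-- **Removing an open piece whose Euler characteristic equals that of its gluing region does
not change the Euler characteristic**: for open `A, T ⊆ X` with `H_•(A ∪ T)` finitely generated
and zero from degree `N` on, and `H_•(T)`, `H_•(A ∩ T)` finitely generated, zero from degree `N`
on and of the same Euler characteristic, `H_•(A)` is finitely generated, zero from degree `N` on,
and `χ(A) = χ(A ∪ T)` (Mayer–Vietoris: `χ(A ∪ T) + χ(A ∩ T) = χ(A) + χ(T)`, Hatcher 2002, §2.2
and Ex. 2.2.20). [cite: HatcherAT2002, §2.2 pp. 149–150 and Thm. 2.44 (proof)] -/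
theorem finRelHomology_left_of_isOpen_union_of_relEuler_eq {A T : Set X} (hA : IsOpen A)
    (hT : IsOpen T) {N : ℕ} (hU : FinRelHomology R M (↥(A ∪ T)) ∅ N)
    (hfT : FinRelHomology R M (↥T) ∅ N) (hAT : FinRelHomology R M (↥(A ∩ T)) ∅ N)
    (hχ : relEuler R M (↥(A ∩ T)) ∅ = relEuler R M (↥T) ∅) :
    FinRelHomology R M (↥A) ∅ N ∧ relEuler R M (↥A) ∅ = relEuler R M (↥(A ∪ T)) ∅ := by
  have hfA := finRelHomology_left_of_isOpen_union R M hA hT hU hAT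
  refine ⟨hfA, ?_⟩
  have key := (finRelHomology_union_of_isOpen R M hA hT hfA hfT hAT).2
  linarith

end ReverseMV

/-! ### §2 The models with coefficients in `M`, in any universe: the circle, the tube `T`, the
punctured tube `T ∖ S`, the handle piece `D⁴ ∖ S` -/

section Models

variable (R : Type v) [CommRing R] [IsNoetherianRing R] [HasRankNullity.{max u v} R] (M : Type v)
  [AddCommGroup M] [Module R M] [Module.Finite R M]

/-- **`χ(S¹; M) = 0`**: a space `Y` (in any universe `u`) homeomorphic to the unit circle has
finitely generated homology with coefficients in `M`, zero from degree `3` on, and Euler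
characteristic `rank M - rank M = 0` — from `χ(D²) = χ(∂D²) + χ(D², ∂D²)` along the exact
sequence of the pair `(D², ∂D²)` lifted to the universe `u` (rank–nullity is only assumed
there). [cite: HatcherAT2002, Example 2.17 (p. 118), with Cor. 2.14] -/
theorem finRelHomology_of_homeomorph_sphere_one {Y : Type u} [TopologicalSpace Y]
    (e : ↥(sphere (0 : EuclideanSpace ℝ (Fin 2)) 1) ≃ₜ Y) :
    FinRelHomology R M Y ∅ 3 ∧ relEuler R M Y ∅ = 0 := by
  haveI : Nontrivial R := nontrivial_of_hasRankNullity.{max u v} R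
  -- the pair `(D², ∂D²)`, lifted to the universe of `Y`
  let D : Type u := ULift.{u} ↥(closedBall (0 : EuclideanSpace ℝ (Fin 2)) 1)
  let eD : D ≃ₜ ↥(closedBall (0 : EuclideanSpace ℝ (Fin 2)) 1) := Homeomorph.ulift
  let S₀ : Set ↥(closedBall (0 : EuclideanSpace ℝ (Fin 2)) 1) :=
    Subtype.val ⁻¹' sphere (0 : EuclideanSpace ℝ (Fin 2)) 1
  let S : Set D := eD ⁻¹' S₀
  haveI : ContractibleSpace D := eD.toHomotopyEquiv.contractibleSpace_iff.2
    (Literature.AlgebraicTopology.SingularHomology.contractibleSpace_closedBall 2)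
  have hX : FinRelHomology R M D ∅ 3 :=
    (finRelHomology_empty_of_contractibleSpace R M).mono (by norm_num)
  have h₁ : MapsTo eD.symm S₀ S := fun x hx => by
    show eD (eD.symm x) ∈ S₀
    rw [eD.apply_symm_apply]
    exact hx
  have h₂ : MapsTo eD.symm.symm S S₀ := fun x hx => hx
  have hDS : FinRelHomology R M D S 3 :=
    (finRelHomology_closedBall_sphere R M 2).of_homeomorph eD.symm h₁ h₂
  have hχDS : relEuler R M D S = (-1 : ℤ) ^ 2 * Module.finrank R M := by
    rw [← relEuler_eq_of_homeomorph (R := R) (M := M) eD.symm h₁ h₂, relEuler_closedBall_sphere]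
  obtain ⟨hA, hχ⟩ := FinRelHomology.triple_left (M := M) (empty_subset S) hX hDS
  rw [relEuler_empty_of_contractibleSpace R M, hχDS,
    relEuler_congr_set (Set.preimage_empty (f := (Subtype.val : ↥S → D)))] at hχ
  -- `↥S ≃ₜ ∂D² ≃ₜ Y`
  let eS : ↥S ≃ₜ Y :=
    ((eD.sets rfl : ↥S ≃ₜ ↥S₀).trans
      (SphereComplement.preimageValHomeomorphOfSubset sphere_subset_closedBall)).trans e
  refine ⟨(hA.congr_set Set.preimage_empty).of_homeomorph eS (mapsTo_empty _ _)
    (mapsTo_empty _ _), ?_⟩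
  rw [← relEuler_eq_of_homeomorph (R := R) (M := M) eS (mapsTo_empty _ _) (mapsTo_empty _ _)]
  norm_num at hχ
  linarith

/-- **Kosinski's tube `T = {x ∈ D⁴ | x_λ ≠ 0}`: `χ(T; M) = 0`.**  A space homeomorphic to `T`
has finitely generated homology with coefficients in `M`, zero from degree `3` on, and Euler
characteristic `0`: `T` deformation retracts onto the parallel circle `K_{1/2}`
(`isStrongDeformationRetractOf_parallel₄_univ`), a circle (`nonempty_sphere_homeomorph_parallel₄`).
[cite: Kosinski1993, VI §6] [cite: HatcherAT2002, Cor. 2.11] -/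
theorem finRelHomology_of_homeomorph_handleTube₄ {Y : Type u} [TopologicalSpace Y]
    (e : ↥(handleTube 3 2) ≃ₜ Y) : FinRelHomology R M Y ∅ 3 ∧ relEuler R M Y ∅ = 0 := by
  set K : Set ↥(handleTube 3 2) :=
    {y | lamSq 2 y.1.1 = (2⁻¹ : ℝ) ^ 2 ∧ muSq 2 y.1.1 = 0} with hK
  -- the parallel circle, through its lift to the universe `u`
  obtain ⟨eK⟩ := nonempty_sphere_homeomorph_parallel₄ (c := 2⁻¹) (by norm_num) (by norm_num)
  obtain ⟨hKf', hKχ'⟩ := finRelHomology_of_homeomorph_sphere_one R M (Y := ULift.{u} ↥K)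
    (eK.trans Homeomorph.ulift.symm)
  have hKf : FinRelHomology R M ↥K ∅ 3 :=
    hKf'.of_homeomorph Homeomorph.ulift (mapsTo_empty _ _) (mapsTo_empty _ _)
  have hKχ : relEuler R M ↥K ∅ = 0 :=
    (relEuler_eq_of_homeomorph Homeomorph.ulift (mapsTo_empty _ _) (mapsTo_empty _ _)).symm.trans
      hKχ'
  -- the deformation retraction of `T` onto it
  have hsdr : IsStrongDeformationRetractOf K univ :=
    isStrongDeformationRetractOf_parallel₄_univ (c := 2⁻¹) (by norm_num) (by norm_num)
  have ei : ∀ k, relativeSingularHomology R M ↥K ∅ k ≅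
      relativeSingularHomology R M ↥(univ : Set ↥(handleTube 3 2)) ∅ k :=
    fun k => hsdr.relativeSingularHomologyIso R M (subset_univ K) (empty_subset K) k
  let eu : ↥(univ : Set ↥(handleTube 3 2)) ≃ₜ Y := (Homeomorph.Set.univ _).trans e
  refine ⟨(hKf.of_iso ei).of_homeomorph eu (mapsTo_empty _ _) (mapsTo_empty _ _), ?_⟩
  rw [← relEuler_eq_of_homeomorph (R := R) (M := M) eu (mapsTo_empty _ _) (mapsTo_empty _ _),
    ← relEuler_eq_of_iso ei, hKχ]

/-- **The punctured tube `T ∖ S`: `χ(T ∖ S; M) = 0`.**  A space homeomorphic to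
`{y ∈ T | |y_λ| ≠ 1}` has finitely generated homology with coefficients in `M`, zero from degree
`3` on, and Euler characteristic `0`: `T ∖ S` deformation retracts onto `K_{1/2}`
(`isStrongDeformationRetractOf_parallel₄_of_lt`). [cite: Kosinski1993, VI §6]
[cite: HatcherAT2002, Cor. 2.11] -/
theorem finRelHomology_of_homeomorph_handleTube₄_lamSq_ne_one {Y : Type u} [TopologicalSpace Y]
    (e : ↥{y : ↥(handleTube 3 2) | lamSq 2 y.1.1 ≠ 1} ≃ₜ Y) :
    FinRelHomology R M Y ∅ 3 ∧ relEuler R M Y ∅ = 0 := by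
  set TS : Set ↥(handleTube 3 2) := {y | lamSq 2 y.1.1 ≠ 1} with hTS
  set K : Set ↥(handleTube 3 2) :=
    {y | lamSq 2 y.1.1 = (2⁻¹ : ℝ) ^ 2 ∧ muSq 2 y.1.1 = 0} with hK
  obtain ⟨eK⟩ := nonempty_sphere_homeomorph_parallel₄ (c := 2⁻¹) (by norm_num) (by norm_num)
  obtain ⟨hKf', hKχ'⟩ := finRelHomology_of_homeomorph_sphere_one R M (Y := ULift.{u} ↥K)
    (eK.trans Homeomorph.ulift.symm)
  have hKf : FinRelHomology R M ↥K ∅ 3 :=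
    hKf'.of_homeomorph Homeomorph.ulift (mapsTo_empty _ _) (mapsTo_empty _ _)
  have hKχ : relEuler R M ↥K ∅ = 0 :=
    (relEuler_eq_of_homeomorph Homeomorph.ulift (mapsTo_empty _ _) (mapsTo_empty _ _)).symm.trans
      hKχ'
  have hKTS : K ⊆ TS := by
    rintro z ⟨hz, -⟩
    show lamSq 2 z.1.1 ≠ 1
    rw [hz]; norm_num
  have hsdr : IsStrongDeformationRetractOf K TS :=
    isStrongDeformationRetractOf_parallel₄_of_lt (c := 2⁻¹) (by norm_num) (by norm_num)
  have ei : ∀ k, relativeSingularHomology R M ↥K ∅ k ≅ relativeSingularHomology R M ↥TS ∅ k :=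
    fun k => hsdr.relativeSingularHomologyIso R M hKTS (empty_subset K) k
  refine ⟨(hKf.of_iso ei).of_homeomorph e (mapsTo_empty _ _) (mapsTo_empty _ _), ?_⟩
  rw [← relEuler_eq_of_homeomorph (R := R) (M := M) e (mapsTo_empty _ _) (mapsTo_empty _ _),
    ← relEuler_eq_of_iso ei, hKχ]

/-- The punctured tube read in the handle piece, `{x ∈ D⁴ ∖ S | x_λ ≠ 0}` — the gluing region
of a `2`-handle: a space homeomorphic to it has finitely generated homology with coefficients in
`M`, zero from degree `3` on, and `χ = 0`. [cite: Kosinski1993, VI §6] -/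
theorem finRelHomology_of_homeomorph_beltPiece₄_lamSq_ne_zero {Y : Type u} [TopologicalSpace Y]
    (e : ↥{b : ↥(beltPiece 3 2) | lamSq 2 b.1.1 ≠ 0} ≃ₜ Y) :
    FinRelHomology R M Y ∅ 3 ∧ relEuler R M Y ∅ = 0 := by
  -- `{b ∈ D⁴ ∖ S | x_λ ≠ 0}` and `{y ∈ T | |y_λ| ≠ 1}` are the same subset of `D⁴`
  let e₀ : ↥{y : ↥(handleTube 3 2) | lamSq 2 y.1.1 ≠ 1} ≃ₜ
      ↥{b : ↥(beltPiece 3 2) | lamSq 2 b.1.1 ≠ 0} :=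
    { toFun := fun y => ⟨⟨y.1.1, y.2⟩, y.1.2⟩
      invFun := fun b => ⟨⟨b.1.1, b.2⟩, b.1.2⟩
      left_inv := fun _ => rfl
      right_inv := fun _ => rfl
      continuous_toFun := by fun_prop
      continuous_invFun := by fun_prop }
  exact finRelHomology_of_homeomorph_handleTube₄_lamSq_ne_one R M (e₀.trans e)

omit [IsNoetherianRing R] in
/-- The handle piece `D⁴ ∖ S` is contractible (`contractibleSpace_beltPiece₄`): a space
homeomorphic to it has finitely generated homology with coefficients in `M`, zero from degree
`1` on, and `χ = rank M`. [cite: HatcherAT2002, Prop. 2.7] -/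
theorem finRelHomology_of_homeomorph_beltPiece₄ {Y : Type u} [TopologicalSpace Y]
    (e : ↥(beltPiece 3 2) ≃ₜ Y) :
    FinRelHomology R M Y ∅ 1 ∧ relEuler R M Y ∅ = Module.finrank R M := by
  haveI : Nontrivial R := nontrivial_of_hasRankNullity.{max u v} R
  haveI : ContractibleSpace Y :=
    e.toHomotopyEquiv.contractibleSpace_iff.1 contractibleSpace_beltPiece₄
  exact ⟨finRelHomology_empty_of_contractibleSpace R M, relEuler_empty_of_contractibleSpace R M⟩

end Models

end Literature.Topology.FourManifolds
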